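import Literature.MathematicalPhysics.QuantumLattice.HubbardModel
import HarnessLib

/-!
# Thermal decay of one-fermion correlations on the Hubbard torus (Hastings 2004)

Topic `Literature/MathematicalPhysics/QuantumLattice`. One NAMED FACT (`def … : Prop`, D-0014),
grounding item `Summit.HubbardSuperconductivity.HubbardSuperconductivity.Theses.LogColdTorus.ThermalChargeDephasing`
(stmt-HubbardSuperconductivity-8813): the item is this fact made UNIFORM in `μ` (the fact is the
literal printed instance, constants depending on `(U, μ)`; the item asks `∀ U ∃ C c₀ ∀ μ`).

Source, read at the page (M. B. Hastings, *Decay of correlations in Fermi systems at nonzero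
temperature*, Phys. Rev. Lett. **93** (2004) 126402 = arXiv:cond-mat/0406348, pp. 2–3 of the
arXiv text, held as `paper:arxiv-cond-mat_0406348`):

* p. 2: "We define the correlation function at inverse temperature `β` by
  `⟨AB⟩_β ≡ Z⁻¹ Tr[A B exp(-βH)]`, where `Z = Tr[exp(-βH)]`. The trace is taken in the grand
  canonical ensemble. Then, we show that if `A` and `B` are fermionic operators separated by
  distance `l` then `⟨AB⟩_β ≤ c ‖A‖ ‖B‖ exp(-l/ξ)` (1), where `c` is a constant and, for large `β`,
  the correlation length `ξ` is of order `vβ`, with `v` a characteristic velocity of the system."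
  (fermionic = sum of products with an odd number of single-site fermion operators; finite-range
  condition `H = Σ_i H_i`, `[H_i, O] = 0` for `O` supported farther than `R` from `i`,
  `‖H_i‖ ≤ J`.)
* p. 3, after (13): "Since `l_j ≥ l`, `g(c₁l, l_j)` decays exponentially for large `l` as
  `exp(-l/ξ_C)`. Also, `exp(-πc₁l/β)` decays exponentially with correlation length `vβ/π`. Thus,
  the correlation length `ξ` is bounded by the maximum of `ξ_C` and `vβ/π`, so that for small
  temperature `ξ ≤ vβ/π`. Thus, Eq. (1) follows." (Proof: the integral representation (4)–(9) of
  `⟨AB⟩_β` through `{A(t), B}` using `(1 + e^{βω})⁻¹ = 1/2 - β⁻¹ Σ_{n odd} (ω - iπn/β)⁻¹` —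
  fermionic Matsubara frequencies omit `0` — and the Lieb–Robinson bound for ANTI-commutators,
  "proven following the same steps as in [Hastings, PRB 69 (2004) 104431] with commutators
  replaced by anti-commutators".)

## The instance stated here

The grand-canonical Hubbard model `hubbardTorusWith 2 L 1 U μ = H(1, U) - μN` on the discrete torus
`(ℤ/Lℤ)²` (nearest-neighbour hopping `t = 1`, on-site `U`: finite range `R = 1`,
`‖H_i‖ ≤ J(U, μ)`), the fermionic operators `A = c†_{xσ}`, `B = c_{yσ}` (`‖A‖ = ‖B‖ = 1`, odd),
`l = torusDist x y`, and Mathlib-matrix Gibbs state `Matrix.gibbsState β H` (`FinDimSpectrum.lean`,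
`= Tr[e^{-βH} ·]/Z`). Reading of the constants: the Lieb–Robinson data `v = c₁⁻¹`, `ξ_C`, `c` of
the finite-range condition are those of THE Hamiltonian whose trace is taken, `H(1,U) - μN`
(`‖H_i‖ ≤ J` with `J ≥ |μ|`), so AS PRINTED the constants depend on `(U, μ)`; they are uniform in
`L` only in the sense that the printed hypotheses (range `R = 1`, the bound `J`, the lattice `ℤ²`
geometry entering the Lieb–Robinson function `g`) are the same for every torus side `L`, which is
how (1) is stated ("for all `i`", no volume dependence). For `β ≥ 1`,
`ξ ≤ max(ξ_C, vβ/π) ≤ max(ξ_C, v/π)·β`, and for `l ≤ β` the trivial bound `|⟨AB⟩_β| ≤ 1` is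
absorbed into the prefactor; hence the printed (1) gives, for each `(U, μ)`, constants `C` and
`c₀ > 0` with `|⟨c†_{xσ} c_{yσ}⟩_{β,L,U,μ}| ≤ C exp(-c₀ · dist(x,y)/β)` for all `β ≥ 1`, `L`, `x`,
`y`, `σ` — the statement below (review of p48467: constants AFTER `∀ U μ`). NOT claimed here,
although it follows from Hastings' PROOF (the phase `e^{iμt}` by which the `(H - μN)`-evolution of
`c_{yσ}` differs from its `H(1,U)`-evolution drops out of `‖{A(t), B}‖`): uniformity of `C, c₀` in
`μ` — this is exactly the surplus of the route item
`LogColdTorus.ThermalChargeDephasing` (`∀ U ∃ C c₀ ∀ μ …`) over the printed theorem, to be PROVED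
there, not assumed. Also not rendered: the general lattice-fermion theorem (arbitrary finite-range
`H`, arbitrary odd `A`, `B`; it needs the fermionic Lieb–Robinson framework, which the tree has
only for bosonic/spin observables) and the canonical-ensemble analogue, flagged as open by
Hastings (p. 4).

## References

* M. B. Hastings, Phys. Rev. Lett. 93 (2004) 126402, arXiv:cond-mat/0406348, eq. (1) and the
  paragraph after eq. (13). [HastingsPRL2004FermiDecay]
* M. B. Hastings, Phys. Rev. B 69 (2004) 104431 (Lieb–Robinson bounds used there). [HastingsPRB2004]
* B. Nachtergaele, R. Sims, Commun. Math. Phys. 265 (2006) 119 (Lieb–Robinson bounds).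
  [NachtergaeleSims2006]
-/

noncomputable section

namespace Literature.MathematicalPhysics.QuantumLattice

open Literature.Probability.LatticeModels
open scoped Matrix

/-- **Hastings 2004, eq. (1) with `ξ ≤ max(ξ_C, vβ/π)` — Hubbard-torus instance (charge `e` is
thermally dead).** For every on-site coupling `U` and chemical potential `μ` there are constants
`C` and `c₀ > 0` such that for every inverse temperature `β ≥ 1`, every side `L` and all torus
sites `x, y` and spins `σ`, the grand-canonical thermal one-body density matrix of
`hubbardTorusWith 2 L 1 U μ` obeys
`|⟨c†_{xσ} c_{yσ}⟩_{β}| ≤ C · exp(-c₀ · dist(x, y)/β)`. Printed: "if `A` and `B` are fermionic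
operators separated by distance `l` then `⟨AB⟩_β ≤ c‖A‖‖B‖exp(-l/ξ)` … the correlation length `ξ`
is bounded by the maximum of `ξ_C` and `vβ/π`" (grand-canonical trace, finite-range lattice
Hamiltonians; constants those of `H(1,U) - μN`, hence depending on `(U, μ)`). Grounds
`Summit.HubbardSuperconductivity.HubbardSuperconductivity.Theses.LogColdTorus.ThermalChargeDephasing`,
which is STRONGER (constants uniform in `μ`). [cite: HastingsPRL2004FermiDecay, eq. (1) and the bound after eq. (13)] -/
def hastings2004_oneBody_thermal_decay_hubbardTorus : Prop :=
  ∀ U μ : ℝ, ∃ C c₀ : ℝ, 0 < c₀ ∧ ∀ (β : ℝ) (L : ℕ) [NeZero L], 1 ≤ β →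
    ∀ (x y : TorusSite 2 L) (σ : Fin 2),
      ‖(hubbardTorusWith 2 L 1 U μ).gibbsState β
          ((annihilation (orb (FermionTorus.ofTorusSite x) σ))ᴴ *
            annihilation (orb (FermionTorus.ofTorusSite y) σ))‖ ≤
        C * Real.exp (-(c₀ * (torusDist x y : ℝ) / β))

end Literature.MathematicalPhysics.QuantumLattice

end
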